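import Summits.QuantumFields.YangMills.Theorems.UnitScaleTiltProp7SymAvgTwFrameAxial
import Literature.MathematicalPhysics.QuantumFieldTheory.Balaban1983to89.B7TransferAnalyticMean
import HarnessLib

/-!
# `UnitScaleTiltProp7SymAvgTwBridge` — THE BRIDGE `QTw = QSym − D_{Ū₀} ∘ r` (OWNER RULING g26-№1 Σ-TWIST (T), item (2)∕(3c)): print's averaging operator `Q(U₀) = QTw U₀` (the linear part
# of the double-bar average [Balaban1985Averaging] (89)–(92), [Balaban1985BackgroundPropagators] p. 392 ∕ (3.14)) IS the route's symmetric linearised average `QSym U₀` (the (AVG-SYM)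
# computational core) MINUS the coarse covariant derivative `D_{Ū₀}` of the LINEARISED ACCUMULATED COMB FRAMES `r := d(frameTw U₀)₀` — by the product rule on
# `U̿^{tw}(A)(c) = w_A(c₋)⁻¹ · [D̄(e^{A}U₀)(c)D̄(U₀)(c)⁻¹] · [Ū₀(c) w_A(c₊) Ū₀(c)⁻¹]` at `A = 0` (`w_0 ≡ 1`, p606182) and `log′(1) = id` (`B7TransferAnalyticMean.hasFDerivAt_mlog_one`)
# (route `UnitScaleTilt`, crux K1 «MinimiserStabilityRegPr» stmt-QuantumFields-19200, stub `stub_existenceMinimalOrbit` (EX), route (α), (AVG-SYM); def-free, count-neutral)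

Cell `ym3-torus` (HUMAN RULING D-0037, YM ladder rung R3 — YM₃ on T³ is a rung, not d = 4, not a mass gap, not Clay), width seat `ym-ust-20520-w5` (gen 3).

THE PRINT.  [Balaban1985BackgroundPropagators] p. 392–393: «the averaging operation used here is the operation U̿ʲ defined by the formulas (89)–(92) of [5] … (1/η_j)Q_j(U, ηA) = Q_j(U)A +
C_j(U, A), (3.14) where Q_j(U)A is a linear part of the function (3.13)».  [Balaban1985Averaging] p. 28 (between (60) and (61)): «If we make a small gauge transformation v = e^{iλ}, then a
good approximation of this transformation acting on Lie algebra variables A is given by A^λ_b = A_b − (R_{0,b}λ(b₊) − λ(b₋)) = A_b − (D_{V₀}λ)(b)»; (89) p. 31.  [Balaban1985Variational] (44) p. 285.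

WHAT IS PROVED (sorry-free, no definition; `M₂ = Matrix (Fin 2) (Fin 2) ℂ` with the `L²`-operator norm; `G(A)(c) := D̄_GL(e^{A}U₀)(c)·D̄_GL(U₀)(c)⁻¹` = the argument of `logChartSym`, ★w4-20520's
«relative iterate»; HYPOTHESES, displayed: `hG : HasFDerivAt G G′ 0` (⇐ ★w4-20520 g2's `Prop7SymAvgRelativeDiff.differentiableAt_relIter_of_plaqSmall` at the T³ letters — junction not typed
here) and `hr : ∀ y, HasFDerivAt (A ↦ frameTw U₀ A y) (r y) 0` (⇐ lit-balaban r04's `B7Prop6GeneralAnalytic.analyticAt_vcovQ`, the frames being `vcov = wrec` — junction not typed here)):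
* §1 `dbarTw_eq_conj`, `logChartTw_apply_conj` (the factorisation above, group algebra), `logChartSym_apply_rel` (`rfl`), `rel_zero` (`G(0) = 1`).
* §2 `covDeriv_pi_apply` (the coarse covariant derivative `(D_{Ū₀}∘r)(A)(c) = r(c₋)A − Ū₀(c)·r(c₊)A·Ū₀(c)⁻¹` as a continuous linear map, inline), ★★★**`hasFDerivAt_logChartTw`** —
  `HasFDerivAt (logChartTw U₀) (G′ − D_{Ū₀}∘r) 0`, ★★★**`QTw_eq_QSym_sub`** — `QTw U₀ = QSym U₀ − D_{Ū₀}∘r` as continuous linear maps, `QTw_apply_eq` (bondwise), `QSym_eq_of_hasFDerivAt` (`QSym U₀ = G′`).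
HONEST FRAMING.  Pure calculus over the defs of p605671 and the axial-slice identities of p606182; the two differentiability hypotheses are displayed by name with their intended suppliers; no
estimate (the sup bound `‖rX‖ ≲ d·L^{K−n}‖X‖` of RULING g26-№1 (3c) is NOT here); nothing of print is asserted.  `--supports stmt-QuantumFields-19200 --as helper`.

References: T. Bałaban, CMP 99 (1985) 389–434 [Balaban1985BackgroundPropagators] (p.392, (3.13)–(3.15) p.393, (3.17) p.393); CMP 98 (1985) 17–51 [Balaban1985Averaging] ((56) p.27, p.28, (82) p.30,
(89)–(92) p.31, (97) p.32); CMP 102 (1985) 277–309 [Balaban1985Variational] ((44) p.285, (47)–(49) p.285).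
-/

set_option autoImplicit false

noncomputable section

open scoped Matrix.Norms.L2Operator

namespace Summit.QuantumFields.YangMills.Theorems.Prop7SymAvgTwBridge

open NormedSpace
open Literature.MathematicalPhysics.QuantumFieldTheory.Balaban1983to89
open Literature.MathematicalPhysics.QuantumFieldTheory.Balaban1983to89.T3ContinuumYM3Torus
open T3SectALandauChart (bgUnits)
open B7Prop1Explicit (expUnit val_expUnit)
open MatrixLog (mlog mlog_one)
open B7TransferAnalyticMean (hasFDerivAt_mlog_one)
open Summit.QuantumFields.YangMills.Theorems.Prop7SymAvgGL (descendToGL logChartSym QSym expUnit_zero_mul_bgUnits)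
open Summit.QuantumFields.YangMills.Theorems.Prop7SymAvgTw (frameTw dbarTw logChartTw QTw)
open Summit.QuantumFields.YangMills.Theorems.Prop7SymAvgTwFrameAxial (frameTw_zero dbarTw_zero)

variable (F : T3Family) {n K : ℕ} (h : n ≤ K)

/-! ## §1 The double-bar average factored through the RELATIVE descended perturbation -/

/-- **`U̿^{tw}(A)(c) = w(c₋)⁻¹ · [D̄(e^{A}U₀)(c)·D̄(U₀)(c)⁻¹] · [D̄(U₀)(c)·w(c₊)·D̄(U₀)(c)⁻¹]`** (group algebra): the double-bar average is the RELATIVE descended perturbation — the argument of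
`logChartSym` — conjugated between the inverse frame at `c₋` and the `Ad_{Ū₀(c)}`-rotated frame at `c₊` (print's `R̄_{0,c}\overline{R_{0,c₊}U₁}` in (89)).
[cite: Balaban1985Averaging, (89) p.31, (56) p.27] -/
theorem dbarTw_eq_conj (U₀ : GaugeField (F.P K) 0 (Matrix.specialUnitaryGroup (Fin 2) ℂ)) (A : PBond (F.P K) 0 → (Matrix (Fin 2) (Fin 2) ℂ)) (c : PBond (F.P n) 0) :
    dbarTw F n K h U₀ A c
      = (frameTw F n K h U₀ A c.src)⁻¹
          * (descendToGL F n K h (fun b => expUnit (A b) * bgUnits F K U₀ b) c * (descendToGL F n K h (bgUnits F K U₀) c)⁻¹)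
          * (descendToGL F n K h (bgUnits F K U₀) c * frameTw F n K h U₀ A c.tgt * (descendToGL F n K h (bgUnits F K U₀) c)⁻¹) := by
  rw [Prop7SymAvgTw.dbarTw_def]; group

/-- The same read in matrices: `logChartTw U₀ A c = log( w(c₋)⁻¹ · G(A)(c) · (Ū₀(c)·w(c₊)·Ū₀(c)⁻¹) )` with `G(A)(c) := D̄(e^{A}U₀)(c)·D̄(U₀)(c)⁻¹` the argument of `logChartSym`.
[cite: Balaban1985Averaging, (89) p.31; Balaban1985Variational, (44) p.285] -/
theorem logChartTw_apply_conj (U₀ : GaugeField (F.P K) 0 (Matrix.specialUnitaryGroup (Fin 2) ℂ)) (A : PBond (F.P K) 0 → (Matrix (Fin 2) (Fin 2) ℂ)) (c : PBond (F.P n) 0) :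
    logChartTw F n K h U₀ A c
      = mlog ((((frameTw F n K h U₀ A c.src)⁻¹ : (Matrix (Fin 2) (Fin 2) ℂ)ˣ) : (Matrix (Fin 2) (Fin 2) ℂ))
          * (((descendToGL F n K h (fun b => expUnit (A b) * bgUnits F K U₀ b) c : (Matrix (Fin 2) (Fin 2) ℂ)ˣ) : (Matrix (Fin 2) (Fin 2) ℂ)) * (((descendToGL F n K h (bgUnits F K U₀) c)⁻¹ : (Matrix (Fin 2) (Fin 2) ℂ)ˣ) : (Matrix (Fin 2) (Fin 2) ℂ)))
          * (((descendToGL F n K h (bgUnits F K U₀) c : (Matrix (Fin 2) (Fin 2) ℂ)ˣ) : (Matrix (Fin 2) (Fin 2) ℂ)) * ((frameTw F n K h U₀ A c.tgt : (Matrix (Fin 2) (Fin 2) ℂ)ˣ) : (Matrix (Fin 2) (Fin 2) ℂ))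
              * (((descendToGL F n K h (bgUnits F K U₀) c)⁻¹ : (Matrix (Fin 2) (Fin 2) ℂ)ˣ) : (Matrix (Fin 2) (Fin 2) ℂ)))) := by
  rw [Prop7SymAvgTw.logChartTw_apply, dbarTw_eq_conj]
  simp only [Units.val_mul]

/-- `logChartSym U₀ A c = log G(A)(c)` (definitional). [cite: Balaban1985Variational, (44) p.285] -/
theorem logChartSym_apply_rel (U₀ : GaugeField (F.P K) 0 (Matrix.specialUnitaryGroup (Fin 2) ℂ)) (A : PBond (F.P K) 0 → (Matrix (Fin 2) (Fin 2) ℂ)) (c : PBond (F.P n) 0) :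
    logChartSym F n K h U₀ A c
      = mlog (((descendToGL F n K h (fun b => expUnit (A b) * bgUnits F K U₀ b) c : (Matrix (Fin 2) (Fin 2) ℂ)ˣ) : (Matrix (Fin 2) (Fin 2) ℂ)) * (((descendToGL F n K h (bgUnits F K U₀) c)⁻¹ : (Matrix (Fin 2) (Fin 2) ℂ)ˣ) : (Matrix (Fin 2) (Fin 2) ℂ))) := rfl

/-- `G(0)(c) = 1` (`e^{0}·U₀♭ = U₀♭`). [cite: Balaban1985Variational, (44) p.285] -/
theorem rel_zero (U₀ : GaugeField (F.P K) 0 (Matrix.specialUnitaryGroup (Fin 2) ℂ)) (c : PBond (F.P n) 0) :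
    ((descendToGL F n K h (fun b => expUnit ((0 : PBond (F.P K) 0 → (Matrix (Fin 2) (Fin 2) ℂ)) b) * bgUnits F K U₀ b) c : (Matrix (Fin 2) (Fin 2) ℂ)ˣ) : (Matrix (Fin 2) (Fin 2) ℂ))
        * (((descendToGL F n K h (bgUnits F K U₀) c)⁻¹ : (Matrix (Fin 2) (Fin 2) ℂ)ˣ) : (Matrix (Fin 2) (Fin 2) ℂ)) = 1 := by
  rw [expUnit_zero_mul_bgUnits, ← Units.val_mul, mul_inv_cancel, Units.val_one]

/-! ## §2 THE BRIDGE `QTw = QSym − D_{Ū₀} ∘ r` (RULING g26-№1 (2), item (3c)) -/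

/-- **THE COARSE COVARIANT DERIVATIVE OF A COARSE GAUGE PARAMETER FIELD, as a continuous linear map on the chart space**: for linear maps `r y : E →L M₂` (one per comparison site —
the linearised frames `r = d(frameTw)₀`), `(D_{Ū₀} ∘ r)(A)(c) := r(c₋)(A) − Ū₀(c)·r(c₊)(A)·Ū₀(c)⁻¹` ([Balaban1985Averaging] p. 28 «A^λ_b = A_b − (R_{0,b}λ(b₊) − λ(b₋)) = A_b − (D_{V₀}λ)(b)»,
here on the comparison lattice with `V₀ = Ū₀ = D̄_GL(U₀)`).  Written inline, no definition. [cite: Balaban1985Averaging, p.28 (between (60) and (61)); Balaban1985BackgroundPropagators, (3.17) p.393] -/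
theorem covDeriv_pi_apply {E : Type*} [NormedAddCommGroup E] [NormedSpace ℂ E] (U₀ : GaugeField (F.P K) 0 (Matrix.specialUnitaryGroup (Fin 2) ℂ))
    (r : Site (F.P n) 0 → (E →L[ℂ] (Matrix (Fin 2) (Fin 2) ℂ))) (A : E) (c : PBond (F.P n) 0) :
    (ContinuousLinearMap.pi fun c : PBond (F.P n) 0 =>
        r c.src - (ContinuousLinearMap.mulLeftRight ℂ (Matrix (Fin 2) (Fin 2) ℂ) ((descendToGL F n K h (bgUnits F K U₀) c : (Matrix (Fin 2) (Fin 2) ℂ)ˣ) : (Matrix (Fin 2) (Fin 2) ℂ))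
          (((descendToGL F n K h (bgUnits F K U₀) c)⁻¹ : (Matrix (Fin 2) (Fin 2) ℂ)ˣ) : (Matrix (Fin 2) (Fin 2) ℂ))).comp (r c.tgt)) A c
      = r c.src A - ((descendToGL F n K h (bgUnits F K U₀) c : (Matrix (Fin 2) (Fin 2) ℂ)ˣ) : (Matrix (Fin 2) (Fin 2) ℂ)) * r c.tgt A * (((descendToGL F n K h (bgUnits F K U₀) c)⁻¹ : (Matrix (Fin 2) (Fin 2) ℂ)ˣ) : (Matrix (Fin 2) (Fin 2) ℂ)) := by
  simp only [ContinuousLinearMap.pi_apply, sub_apply, ContinuousLinearMap.comp_apply, ContinuousLinearMap.mulLeftRight_apply]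

/-- ★★★ **THE BRIDGE, DERIVATIVE FORM**: let `G(A)(c) = D̄(e^{A}U₀)(c)·D̄(U₀)(c)⁻¹` (the argument of `logChartSym`) be differentiable at `A = 0` with derivative `G′` (so `QSym U₀ = G′`, since
`log′(1) = id`), and let every frame `A ↦ frameTw U₀ A y` be differentiable at `0` with derivative `r y` (the linearised accumulated comb frames; `frameTw U₀ 0 ≡ 1`, p606182).  Then the twisted
log-chart is differentiable at `0` with derivative **`G′ − D_{Ū₀} ∘ r`**: `d[log(w₋⁻¹·G·Ū₀w₊Ū₀⁻¹)]₀ = −r(c₋) + G′ + Ū₀(c)·r(c₊)·Ū₀(c)⁻¹` (product rule at `w = 1`, `G = 1`; `d(w⁻¹) = −dw`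
at `w = 1`; `log′(1) = id`). [cite: Balaban1985Averaging, (89) p.31, p.28; Balaban1985BackgroundPropagators, (3.14) p.393; Balaban1985Variational, (44) p.285] -/
theorem hasFDerivAt_logChartTw (U₀ : GaugeField (F.P K) 0 (Matrix.specialUnitaryGroup (Fin 2) ℂ))
    {G' : (PBond (F.P K) 0 → (Matrix (Fin 2) (Fin 2) ℂ)) →L[ℂ] (PBond (F.P n) 0 → (Matrix (Fin 2) (Fin 2) ℂ))}
    (hG : HasFDerivAt (fun A : PBond (F.P K) 0 → (Matrix (Fin 2) (Fin 2) ℂ) => fun c : PBond (F.P n) 0 =>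
        ((descendToGL F n K h (fun b => expUnit (A b) * bgUnits F K U₀ b) c : (Matrix (Fin 2) (Fin 2) ℂ)ˣ) : (Matrix (Fin 2) (Fin 2) ℂ)) * (((descendToGL F n K h (bgUnits F K U₀) c)⁻¹ : (Matrix (Fin 2) (Fin 2) ℂ)ˣ) : (Matrix (Fin 2) (Fin 2) ℂ))) G' 0)
    {r : Site (F.P n) 0 → ((PBond (F.P K) 0 → (Matrix (Fin 2) (Fin 2) ℂ)) →L[ℂ] (Matrix (Fin 2) (Fin 2) ℂ))}
    (hr : ∀ y, HasFDerivAt (fun A : PBond (F.P K) 0 → (Matrix (Fin 2) (Fin 2) ℂ) => ((frameTw F n K h U₀ A y : (Matrix (Fin 2) (Fin 2) ℂ)ˣ) : (Matrix (Fin 2) (Fin 2) ℂ))) (r y) 0) :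
    HasFDerivAt (logChartTw F n K h U₀)
      (G' - ContinuousLinearMap.pi fun c : PBond (F.P n) 0 =>
        r c.src - (ContinuousLinearMap.mulLeftRight ℂ (Matrix (Fin 2) (Fin 2) ℂ) ((descendToGL F n K h (bgUnits F K U₀) c : (Matrix (Fin 2) (Fin 2) ℂ)ˣ) : (Matrix (Fin 2) (Fin 2) ℂ))
          (((descendToGL F n K h (bgUnits F K U₀) c)⁻¹ : (Matrix (Fin 2) (Fin 2) ℂ)ˣ) : (Matrix (Fin 2) (Fin 2) ℂ))).comp (r c.tgt)) 0 := by
  -- coordinatewise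
  apply hasFDerivAt_pi''
  intro c
  -- letters at the bond `c`
  set P₀ : (Matrix (Fin 2) (Fin 2) ℂ) := ((descendToGL F n K h (bgUnits F K U₀) c : (Matrix (Fin 2) (Fin 2) ℂ)ˣ) : (Matrix (Fin 2) (Fin 2) ℂ)) with hP₀
  set P₀i : (Matrix (Fin 2) (Fin 2) ℂ) := (((descendToGL F n K h (bgUnits F K U₀) c)⁻¹ : (Matrix (Fin 2) (Fin 2) ℂ)ˣ) : (Matrix (Fin 2) (Fin 2) ℂ)) with hP₀i
  have hPP : P₀ * P₀i = 1 := by rw [hP₀, hP₀i, ← Units.val_mul, mul_inv_cancel, Units.val_one]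
  -- the three factors as functions of `A`
  set Gc : (PBond (F.P K) 0 → (Matrix (Fin 2) (Fin 2) ℂ)) → (Matrix (Fin 2) (Fin 2) ℂ) := fun A =>
    ((descendToGL F n K h (fun b => expUnit (A b) * bgUnits F K U₀ b) c : (Matrix (Fin 2) (Fin 2) ℂ)ˣ) : (Matrix (Fin 2) (Fin 2) ℂ)) * P₀i with hGc
  set Wm : (PBond (F.P K) 0 → (Matrix (Fin 2) (Fin 2) ℂ)) → (Matrix (Fin 2) (Fin 2) ℂ) := fun A => ((frameTw F n K h U₀ A c.src : (Matrix (Fin 2) (Fin 2) ℂ)ˣ) : (Matrix (Fin 2) (Fin 2) ℂ)) with hWm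
  set Wp : (PBond (F.P K) 0 → (Matrix (Fin 2) (Fin 2) ℂ)) → (Matrix (Fin 2) (Fin 2) ℂ) := fun A => ((frameTw F n K h U₀ A c.tgt : (Matrix (Fin 2) (Fin 2) ℂ)ˣ) : (Matrix (Fin 2) (Fin 2) ℂ)) with hWp
  set Wmi : (PBond (F.P K) 0 → (Matrix (Fin 2) (Fin 2) ℂ)) → (Matrix (Fin 2) (Fin 2) ℂ) := fun A => (((frameTw F n K h U₀ A c.src)⁻¹ : (Matrix (Fin 2) (Fin 2) ℂ)ˣ) : (Matrix (Fin 2) (Fin 2) ℂ)) with hWmi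
  -- their derivatives at 0
  have hGc' : HasFDerivAt Gc ((ContinuousLinearMap.proj c).comp G') 0 := by
    have := (hasFDerivAt_pi'.1 hG) c
    exact this
  have hGc0 : Gc 0 = 1 := by rw [hGc]; exact rel_zero F h U₀ c
  have hWm' : HasFDerivAt Wm (r c.src) 0 := hr c.src
  have hWp' : HasFDerivAt Wp (r c.tgt) 0 := hr c.tgt
  have hWm0 : Wm 0 = 1 := by rw [hWm]; simp only [frameTw_zero, Units.val_one]
  have hWp0 : Wp 0 = 1 := by rw [hWp]; simp only [frameTw_zero, Units.val_one]
  -- the inverse frame: `Ring.inverse ∘ Wm`, derivative `−r(c₋)` at `Wm 0 = 1`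
  have hWmi_eq : Wmi = fun A => Ring.inverse (Wm A) := by
    funext A; rw [hWmi, hWm]; exact (Ring.inverse_unit _).symm
  have hinv1 : HasFDerivAt (Ring.inverse : (Matrix (Fin 2) (Fin 2) ℂ) → (Matrix (Fin 2) (Fin 2) ℂ)) (-ContinuousLinearMap.mulLeftRight ℂ (Matrix (Fin 2) (Fin 2) ℂ) (1 : (Matrix (Fin 2) (Fin 2) ℂ)) (1 : (Matrix (Fin 2) (Fin 2) ℂ))) (Wm 0) := by
    rw [hWm0]
    have := hasFDerivAt_ringInverse (𝕜 := ℂ) (1 : (Matrix (Fin 2) (Fin 2) ℂ)ˣ)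
    simpa using this
  have hWmi' : HasFDerivAt Wmi ((-ContinuousLinearMap.mulLeftRight ℂ (Matrix (Fin 2) (Fin 2) ℂ) (1 : (Matrix (Fin 2) (Fin 2) ℂ)) (1 : (Matrix (Fin 2) (Fin 2) ℂ))).comp (r c.src)) 0 := by
    rw [hWmi_eq]; exact hinv1.comp 0 hWm'
  have hWmi0 : Wmi 0 = 1 := by rw [hWmi]; simp only [frameTw_zero, inv_one, Units.val_one]
  -- the rotated frame `P₀ · Wp · P₀⁻¹`
  set Rot : (PBond (F.P K) 0 → (Matrix (Fin 2) (Fin 2) ℂ)) → (Matrix (Fin 2) (Fin 2) ℂ) := fun A => P₀ * Wp A * P₀i with hRot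
  have hRot' := (hWp'.const_mul P₀).mul_const' P₀i
  have hRot0 : Rot 0 = 1 := by rw [hRot]; simp only [hWp0, mul_one, hPP]
  -- the product `Wmi · Gc · Rot` and `mlog` of it
  have hprod := (hWmi'.mul' hGc').mul' hRot'
  have hval0 : Wmi 0 * Gc 0 * Rot 0 = 1 := by rw [hWmi0, hGc0, hRot0, one_mul, one_mul]
  have hmlog : HasFDerivAt (mlog : (Matrix (Fin 2) (Fin 2) ℂ) → (Matrix (Fin 2) (Fin 2) ℂ)) (1 : (Matrix (Fin 2) (Fin 2) ℂ) →L[ℂ] (Matrix (Fin 2) (Fin 2) ℂ)) (Wmi 0 * Gc 0 * (fun A => P₀ * Wp A * P₀i) 0) := by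
    rw [show (fun A => P₀ * Wp A * P₀i) 0 = Rot 0 from rfl, hval0]; exact hasFDerivAt_mlog_one
  have hcomp := hmlog.comp 0 hprod
  -- identify the function and the derivative
  have hfun : (fun A => logChartTw F n K h U₀ A c) = fun A => mlog (Wmi A * Gc A * (P₀ * Wp A * P₀i)) := by
    funext A
    rw [logChartTw_apply_conj]
  rw [hfun]
  rw [ContinuousLinearMap.one_def, ContinuousLinearMap.id_comp] at hcomp
  refine hcomp.congr_fderiv (ContinuousLinearMap.ext fun A => ?_)
  have hGc0' : Gc 0 = 1 := hGc0
  simp only [ContinuousLinearMap.comp_apply, add_apply, sub_apply, neg_apply, smul_apply, Pi.mul_apply, Pi.sub_apply,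
    op_smul_eq_mul, smul_eq_mul, ContinuousLinearMap.proj_apply, ContinuousLinearMap.pi_apply, ContinuousLinearMap.mulLeftRight_apply,
    hWmi0, hGc0', hWp0, one_mul, mul_one, hPP, one_smul]
  rw [← hP₀i, ← hP₀]
  abel

/-- ★★★ **THE BRIDGE `QTw = QSym − D_{Ū₀} ∘ r`** (RULING g26-№1 (2): the computational core `QSym` is consumed through this identity): under the hypotheses of `hasFDerivAt_logChartTw`,
print's averaging operator `Q(U₀) = QTw U₀` is the symmetric linearised average `QSym U₀` MINUS the coarse covariant derivative of the linearised frames `r`.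
[cite: Balaban1985BackgroundPropagators, (3.14)–(3.15) p.393; Balaban1985Averaging, (89) p.31, p.28; Balaban1985Variational, (44) p.285] -/
theorem QTw_eq_QSym_sub (U₀ : GaugeField (F.P K) 0 (Matrix.specialUnitaryGroup (Fin 2) ℂ))
    {G' : (PBond (F.P K) 0 → (Matrix (Fin 2) (Fin 2) ℂ)) →L[ℂ] (PBond (F.P n) 0 → (Matrix (Fin 2) (Fin 2) ℂ))}
    (hG : HasFDerivAt (fun A : PBond (F.P K) 0 → (Matrix (Fin 2) (Fin 2) ℂ) => fun c : PBond (F.P n) 0 =>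
        ((descendToGL F n K h (fun b => expUnit (A b) * bgUnits F K U₀ b) c : (Matrix (Fin 2) (Fin 2) ℂ)ˣ) : (Matrix (Fin 2) (Fin 2) ℂ)) * (((descendToGL F n K h (bgUnits F K U₀) c)⁻¹ : (Matrix (Fin 2) (Fin 2) ℂ)ˣ) : (Matrix (Fin 2) (Fin 2) ℂ))) G' 0)
    {r : Site (F.P n) 0 → ((PBond (F.P K) 0 → (Matrix (Fin 2) (Fin 2) ℂ)) →L[ℂ] (Matrix (Fin 2) (Fin 2) ℂ))}
    (hr : ∀ y, HasFDerivAt (fun A : PBond (F.P K) 0 → (Matrix (Fin 2) (Fin 2) ℂ) => ((frameTw F n K h U₀ A y : (Matrix (Fin 2) (Fin 2) ℂ)ˣ) : (Matrix (Fin 2) (Fin 2) ℂ))) (r y) 0) :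
    QTw F n K h U₀ = QSym F n K h U₀ - ContinuousLinearMap.pi fun c : PBond (F.P n) 0 =>
        r c.src - (ContinuousLinearMap.mulLeftRight ℂ (Matrix (Fin 2) (Fin 2) ℂ) ((descendToGL F n K h (bgUnits F K U₀) c : (Matrix (Fin 2) (Fin 2) ℂ)ˣ) : (Matrix (Fin 2) (Fin 2) ℂ))
          (((descendToGL F n K h (bgUnits F K U₀) c)⁻¹ : (Matrix (Fin 2) (Fin 2) ℂ)ˣ) : (Matrix (Fin 2) (Fin 2) ℂ))).comp (r c.tgt) := by
  -- `QSym = G′`: `logChartSym = mlog ∘ G` coordinatewise, `G(0) = 1`, `log′(1) = id`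
  have hS : HasFDerivAt (logChartSym F n K h U₀) G' 0 := by
    apply hasFDerivAt_pi''
    intro c
    have hGc : HasFDerivAt (fun A : PBond (F.P K) 0 → (Matrix (Fin 2) (Fin 2) ℂ) =>
        ((descendToGL F n K h (fun b => expUnit (A b) * bgUnits F K U₀ b) c : (Matrix (Fin 2) (Fin 2) ℂ)ˣ) : (Matrix (Fin 2) (Fin 2) ℂ)) * (((descendToGL F n K h (bgUnits F K U₀) c)⁻¹ : (Matrix (Fin 2) (Fin 2) ℂ)ˣ) : (Matrix (Fin 2) (Fin 2) ℂ)))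
        ((ContinuousLinearMap.proj c).comp G') 0 := (hasFDerivAt_pi'.1 hG) c
    have hmlog : HasFDerivAt (mlog : (Matrix (Fin 2) (Fin 2) ℂ) → (Matrix (Fin 2) (Fin 2) ℂ)) (1 : (Matrix (Fin 2) (Fin 2) ℂ) →L[ℂ] (Matrix (Fin 2) (Fin 2) ℂ))
        (((descendToGL F n K h (fun b => expUnit ((0 : PBond (F.P K) 0 → (Matrix (Fin 2) (Fin 2) ℂ)) b) * bgUnits F K U₀ b) c : (Matrix (Fin 2) (Fin 2) ℂ)ˣ) : (Matrix (Fin 2) (Fin 2) ℂ))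
          * (((descendToGL F n K h (bgUnits F K U₀) c)⁻¹ : (Matrix (Fin 2) (Fin 2) ℂ)ˣ) : (Matrix (Fin 2) (Fin 2) ℂ))) := by
      rw [rel_zero]; exact hasFDerivAt_mlog_one
    have hcomp := hmlog.comp 0 hGc
    rw [ContinuousLinearMap.one_def, ContinuousLinearMap.id_comp] at hcomp
    exact hcomp
  rw [Prop7SymAvgTw.QTw_def, Summit.QuantumFields.YangMills.Theorems.Prop7SymAvgGL.QSym, (hasFDerivAt_logChartTw F h U₀ hG hr).fderiv, hS.fderiv]

/-- **THE BRIDGE, APPLIED**: `QTw U₀ A c = QSym U₀ A c − (r(c₋)A − Ū₀(c)·r(c₊)A·Ū₀(c)⁻¹)`. [cite: Balaban1985BackgroundPropagators, (3.14) p.393; Balaban1985Averaging, p.28] -/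
theorem QTw_apply_eq (U₀ : GaugeField (F.P K) 0 (Matrix.specialUnitaryGroup (Fin 2) ℂ))
    {G' : (PBond (F.P K) 0 → (Matrix (Fin 2) (Fin 2) ℂ)) →L[ℂ] (PBond (F.P n) 0 → (Matrix (Fin 2) (Fin 2) ℂ))}
    (hG : HasFDerivAt (fun A : PBond (F.P K) 0 → (Matrix (Fin 2) (Fin 2) ℂ) => fun c : PBond (F.P n) 0 =>
        ((descendToGL F n K h (fun b => expUnit (A b) * bgUnits F K U₀ b) c : (Matrix (Fin 2) (Fin 2) ℂ)ˣ) : (Matrix (Fin 2) (Fin 2) ℂ)) * (((descendToGL F n K h (bgUnits F K U₀) c)⁻¹ : (Matrix (Fin 2) (Fin 2) ℂ)ˣ) : (Matrix (Fin 2) (Fin 2) ℂ))) G' 0)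
    {r : Site (F.P n) 0 → ((PBond (F.P K) 0 → (Matrix (Fin 2) (Fin 2) ℂ)) →L[ℂ] (Matrix (Fin 2) (Fin 2) ℂ))}
    (hr : ∀ y, HasFDerivAt (fun A : PBond (F.P K) 0 → (Matrix (Fin 2) (Fin 2) ℂ) => ((frameTw F n K h U₀ A y : (Matrix (Fin 2) (Fin 2) ℂ)ˣ) : (Matrix (Fin 2) (Fin 2) ℂ))) (r y) 0)
    (A : PBond (F.P K) 0 → (Matrix (Fin 2) (Fin 2) ℂ)) (c : PBond (F.P n) 0) :
    QTw F n K h U₀ A c = QSym F n K h U₀ A c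
      - (r c.src A - ((descendToGL F n K h (bgUnits F K U₀) c : (Matrix (Fin 2) (Fin 2) ℂ)ˣ) : (Matrix (Fin 2) (Fin 2) ℂ)) * r c.tgt A * (((descendToGL F n K h (bgUnits F K U₀) c)⁻¹ : (Matrix (Fin 2) (Fin 2) ℂ)ˣ) : (Matrix (Fin 2) (Fin 2) ℂ))) := by
  rw [QTw_eq_QSym_sub F h U₀ hG hr, sub_apply, Pi.sub_apply, covDeriv_pi_apply]

/-- **`QSym` IS the derivative of the relative descended perturbation** (`log′(1) = id`): under `hG`, `QSym U₀ = G′`. [cite: Balaban1985Variational, (44) p.285] -/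
theorem QSym_eq_of_hasFDerivAt (U₀ : GaugeField (F.P K) 0 (Matrix.specialUnitaryGroup (Fin 2) ℂ))
    {G' : (PBond (F.P K) 0 → (Matrix (Fin 2) (Fin 2) ℂ)) →L[ℂ] (PBond (F.P n) 0 → (Matrix (Fin 2) (Fin 2) ℂ))}
    (hG : HasFDerivAt (fun A : PBond (F.P K) 0 → (Matrix (Fin 2) (Fin 2) ℂ) => fun c : PBond (F.P n) 0 =>
        ((descendToGL F n K h (fun b => expUnit (A b) * bgUnits F K U₀ b) c : (Matrix (Fin 2) (Fin 2) ℂ)ˣ) : (Matrix (Fin 2) (Fin 2) ℂ)) * (((descendToGL F n K h (bgUnits F K U₀) c)⁻¹ : (Matrix (Fin 2) (Fin 2) ℂ)ˣ) : (Matrix (Fin 2) (Fin 2) ℂ))) G' 0) :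
    QSym F n K h U₀ = G' := by
  have hS : HasFDerivAt (logChartSym F n K h U₀) G' 0 := by
    apply hasFDerivAt_pi''
    intro c
    have hGc : HasFDerivAt (fun A : PBond (F.P K) 0 → (Matrix (Fin 2) (Fin 2) ℂ) =>
        ((descendToGL F n K h (fun b => expUnit (A b) * bgUnits F K U₀ b) c : (Matrix (Fin 2) (Fin 2) ℂ)ˣ) : (Matrix (Fin 2) (Fin 2) ℂ)) * (((descendToGL F n K h (bgUnits F K U₀) c)⁻¹ : (Matrix (Fin 2) (Fin 2) ℂ)ˣ) : (Matrix (Fin 2) (Fin 2) ℂ)))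
        ((ContinuousLinearMap.proj c).comp G') 0 := (hasFDerivAt_pi'.1 hG) c
    have hmlog : HasFDerivAt (mlog : (Matrix (Fin 2) (Fin 2) ℂ) → (Matrix (Fin 2) (Fin 2) ℂ)) (1 : (Matrix (Fin 2) (Fin 2) ℂ) →L[ℂ] (Matrix (Fin 2) (Fin 2) ℂ))
        (((descendToGL F n K h (fun b => expUnit ((0 : PBond (F.P K) 0 → (Matrix (Fin 2) (Fin 2) ℂ)) b) * bgUnits F K U₀ b) c : (Matrix (Fin 2) (Fin 2) ℂ)ˣ) : (Matrix (Fin 2) (Fin 2) ℂ))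
          * (((descendToGL F n K h (bgUnits F K U₀) c)⁻¹ : (Matrix (Fin 2) (Fin 2) ℂ)ˣ) : (Matrix (Fin 2) (Fin 2) ℂ))) := by
      rw [rel_zero]; exact hasFDerivAt_mlog_one
    have hcomp := hmlog.comp 0 hGc
    rw [ContinuousLinearMap.one_def, ContinuousLinearMap.id_comp] at hcomp
    exact hcomp
  rw [Summit.QuantumFields.YangMills.Theorems.Prop7SymAvgGL.QSym, hS.fderiv]

end Summit.QuantumFields.YangMills.Theorems.Prop7SymAvgTwBridge

end
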